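import Mathlib
import Literature.MathematicalPhysics.QuantumFieldTheory.Luscher2010.TrivializingMaps

/-!
# Lüscher 2010 — proofs: global existence, uniqueness and continuity of the flow of a `C¹`
# tangent generator on `SU(n)^E` (§3.1)

M. Lüscher, *Trivializing maps, the Wilson flow and the HMC algorithm*, Commun. Math. Phys. 293
(2010) 899–919 [Luscher2010Trivializing], §3.1 (paragraph after eq. (3.3), citing Arnold §35): "If
`Z_t(U)` is a differentiable function of `t` and `U`, the flow equation (3.2) has a unique solution
`U_t` for any specified initial value `U_0 = V` and all `t ∈ (-∞,∞)` … the existence of the solution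
for all times … can only be guaranteed, without further assumptions, because the field manifold is
compact."  File A (`Luscher2010/TrivializingMaps.lean`) records this as the cited `Prop`
`FlowGlobalExistence d L n`; this file PROVES it (`flowGlobalExistence_holds`), for every `d`, `L ≥ 1`,
`n`, by the method the tree already uses for the Wilson generator (`WilsonFlow.lean`):

* replace the generator by its projected, compactly cut-off ambient version
  `(t, W) ↦ (χ(W) • 𝒫 Z_t(W)(e)) · W(e)` (`vf`; `χ` = `WilsonFlow.cutoff`, `𝒫` = `suProj`), which is
  `C¹` on `ℝ × M_n(ℂ)^E`, bounded, and Lipschitz on balls uniformly on compact time intervals, so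
  that Mathlib's Picard–Lindelöf theorem (`IsPicardLindelof`) gives local flows on `[-T, T]` for every
  `T` (`exists_locFlow`);
* linkwise the cut-off field is "(anti-Hermitian traceless) × link", so `SU(n)^E` is invariant
  (`WilsonFlow.mem_SU_of_ode`: `d/dt UᴴU = 0`, Liouville `d/dt det U = 0`) — `locFlow_mem_SU`;
* ON `SU(n)^E` the cut-off is inactive and `𝒫 Z_t = Z_t` by tangency, so the local flows solve the
  TRUE flow equation `U̇ = Z_t(U) U` (`hasDerivWithinAt_locFlow_vf₀`);
* Grönwall uniqueness for the true equation among curves that stay in a bounded set — which every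
  continuous curve does on a compact time interval — (`eqOn_of_isSolution`) glues the local flows
  into a global one (`ambLine`), identifies every ambient flow line through an `SU(n)` point with it,
  and joint continuity in `(t, V)` comes from the Lipschitz dependence of the local flows on the
  initial point (`continuous_flowMap`).

HONEST FRAMING: exact (Metropolis-corrected) sampling algorithms for lattice gauge theory; figures
of merit are autocorrelation/cost numbers at stated couplings and volumes; no continuum-physics claim.
Cell pub-lqcd (venture LatticeQCDFlow), row 31 (lean-2); discharges the first of the two cited
§3 inputs of `Summits/Ventures/LatticeQCDFlow/TrivializingMaps/DefectLogWeightMeasure.lean`.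
-/

noncomputable section

open Matrix Set Metric Filter Function
open scoped Matrix Topology NNReal

namespace Literature.MathematicalPhysics.QuantumFieldTheory.Luscher2010

open Literature.MathematicalPhysics.QuantumFieldTheory
open Literature.MathematicalPhysics.QuantumFieldTheory.WilsonFlow

variable {d L n : ℕ}

namespace FlowExistence

open scoped Matrix.Norms.Frobenius

/-! ### The true ambient field and its Lipschitz bounds -/

/-- The true ambient vector field `(t, W) ↦ (Z_t(W)(e) · W(e))_e` of the flow equation (3.2).
[cite: Luscher2010Trivializing, §3.1 eq. (3.2)] -/
def vf₀ (Z : Generator d L n) (t : ℝ) (W : AmbConfig d L n) : AmbConfig d L n :=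
  fun e => Z t W e * W e

/-- `vf₀` evaluated. [folklore] -/
private theorem vf₀_apply (Z : Generator d L n) (t : ℝ) (W : AmbConfig d L n) (e : Edge d L) :
    vf₀ Z t W e = Z t W e * W e := rfl

section Analysis

variable [NeZero L] {Z : Generator d L n}

/-- The true ambient field is `C¹` jointly in `(t, W)` when the generator is. [folklore] -/
private theorem contDiff_vf₀ (hZ : ContDiff ℝ 1 (fun p : ℝ × AmbConfig d L n => Z p.1 p.2)) :
    ContDiff ℝ 1 (fun p : ℝ × AmbConfig d L n => vf₀ Z p.1 p.2) :=
  contDiff_pi.2 fun e => ((contDiff_eval e).comp hZ).mul ((contDiff_eval e).comp contDiff_snd)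

/-- A jointly `C¹` field is Lipschitz in the configuration on every ball, uniformly on every compact
time interval. [folklore] -/
private theorem exists_lipschitzOnWith_of_contDiff {F : ℝ → AmbConfig d L n → AmbConfig d L n}
    (hF : ContDiff ℝ 1 (fun p : ℝ × AmbConfig d L n => F p.1 p.2)) (T R : ℝ) :
    ∃ K : ℝ≥0, ∀ t ∈ Icc (-T) T, LipschitzOnWith K (F t) (closedBall (0 : AmbConfig d L n) R) := by
  obtain ⟨K, hK⟩ := hF.contDiffOn.exists_lipschitzOnWith one_ne_zero
    ((convex_Icc (-T) T).prod (convex_closedBall (0 : AmbConfig d L n) R))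
    (isCompact_Icc.prod (isCompact_closedBall (0 : AmbConfig d L n) R))
  refine ⟨K, fun t ht => ?_⟩
  intro W₁ hW₁ W₂ hW₂
  have h := hK (mk_mem_prod ht hW₁) (mk_mem_prod ht hW₂)
  simp only [Prod.edist_eq, edist_self, zero_max] at h
  exact h

/-- **Uniqueness for the true flow equation** (Grönwall): two solutions of `Ẇ = Z_t(W) W` on
`(-T, T)`, continuous on `[-T, T]` and equal at `t = 0`, coincide on `[-T, T]`.  (Each stays in a
bounded set by compactness of `[-T, T]`, where the `C¹` field is Lipschitz.)  This is the
uniqueness clause of "the flow equation (3.2) has a unique solution".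
[cite: Luscher2010Trivializing, §3.1 (paragraph after eq. (3.3))] -/
theorem eqOn_of_isSolution (hZ : ContDiff ℝ 1 (fun p : ℝ × AmbConfig d L n => Z p.1 p.2))
    {f g : ℝ → AmbConfig d L n} {T : ℝ} (hT : 0 < T)
    (hfc : ContinuousOn f (Icc (-T) T)) (hf : ∀ t ∈ Ioo (-T) T, HasDerivAt f (vf₀ Z t (f t)) t)
    (hgc : ContinuousOn g (Icc (-T) T)) (hg : ∀ t ∈ Ioo (-T) T, HasDerivAt g (vf₀ Z t (g t)) t)
    (h0 : f 0 = g 0) : EqOn f g (Icc (-T) T) := by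
  obtain ⟨Rf, hRf⟩ := (isCompact_Icc.image_of_continuousOn hfc).isBounded.subset_closedBall 0
  obtain ⟨Rg, hRg⟩ := (isCompact_Icc.image_of_continuousOn hgc).isBounded.subset_closedBall 0
  obtain ⟨K, hK⟩ := exists_lipschitzOnWith_of_contDiff (contDiff_vf₀ hZ) T (max Rf Rg)
  refine ODE_solution_unique_of_mem_Icc (v := vf₀ Z) (s := fun _ => closedBall 0 (max Rf Rg))
    (K := K) (t₀ := 0) (fun t ht => hK t (Ioo_subset_Icc_self ht)) ⟨by linarith, hT⟩ hfc hf
    (fun t ht => closedBall_subset_closedBall (le_max_left _ _)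
      (hRf ⟨t, Ioo_subset_Icc_self ht, rfl⟩)) hgc hg
    (fun t ht => closedBall_subset_closedBall (le_max_right _ _)
      (hRg ⟨t, Ioo_subset_Icc_self ht, rfl⟩)) h0

/-! ### The projected, cut-off field and Picard–Lindelöf on `[-T, T]` -/

/-- The projected, cut-off ambient field `(t, W) ↦ ((χ(W) • 𝒫 Z_t(W)(e)) · W(e))_e`. [folklore] -/
private def vf (Z : Generator d L n) (t : ℝ) (W : AmbConfig d L n) : AmbConfig d L n :=
  fun e => (cutoff W • suProj (Z t W e)) * W e

/-- `vf` evaluated. [folklore] -/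
private theorem vf_apply (Z : Generator d L n) (t : ℝ) (W : AmbConfig d L n) (e : Edge d L) :
    vf Z t W e = (cutoff W • suProj (Z t W e)) * W e := rfl

/-- The cut-off field is `C¹` jointly in `(t, W)`. [folklore] -/
private theorem contDiff_vf (hZ : ContDiff ℝ 1 (fun p : ℝ × AmbConfig d L n => Z p.1 p.2)) :
    ContDiff ℝ 1 (fun p : ℝ × AmbConfig d L n => vf Z p.1 p.2) :=
  contDiff_pi.2 fun e =>
    (((contDiff_cutoff (m := 1)).comp contDiff_snd).smul
      (contDiff_suProj.comp ((contDiff_eval e).comp hZ))).mul ((contDiff_eval e).comp contDiff_snd)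

/-- The cut-off vanishes outside `closedBall 0 √(qmax + 2)`. [folklore] -/
private theorem cutoff_eq_zero_of_norm_lt {W : AmbConfig d L n} (hW : √(qmax d L n + 2) < ‖W‖) :
    cutoff W = 0 := by
  refine cutoff_eq_zero ?_
  have h := hW.trans_le (norm_le_sqrt_sqNorm W)
  have hq : 0 ≤ qmax d L n + 2 := by unfold qmax; positivity
  exact ((Real.sqrt_lt_sqrt_iff hq).1 h).le

/-- The cut-off field vanishes outside `closedBall 0 √(qmax + 2)`. [folklore] -/
private theorem vf_eq_zero_of_norm_lt (t : ℝ) {W : AmbConfig d L n} (hW : √(qmax d L n + 2) < ‖W‖) :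
    vf Z t W = 0 := by
  funext e
  rw [vf_apply, cutoff_eq_zero_of_norm_lt hW, zero_smul, zero_mul, Pi.zero_apply]

/-- A bound of the cut-off field, uniform in the configuration and on a compact time interval. [folklore] -/
private theorem exists_bound_vf (hZ : ContDiff ℝ 1 (fun p : ℝ × AmbConfig d L n => Z p.1 p.2)) (T : ℝ) :
    ∃ C : ℝ≥0, ∀ t ∈ Icc (-T) T, ∀ W, ‖vf Z t W‖ ≤ C := by
  obtain ⟨C, hC⟩ := (isCompact_Icc.prod (isCompact_closedBall (0 : AmbConfig d L n)
    (√(qmax d L n + 2)))).exists_bound_of_continuousOn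
      ((contDiff_vf hZ).continuous.continuousOn (s := Icc (-T) T ×ˢ closedBall 0 _))
  refine ⟨⟨max C 0, le_max_right _ _⟩, fun t ht W => ?_⟩
  by_cases hW : ‖W‖ ≤ √(qmax d L n + 2)
  · exact (hC (t, W) (mk_mem_prod ht (mem_closedBall_zero_iff.2 hW))).trans (le_max_left _ _)
  · rw [vf_eq_zero_of_norm_lt t (lt_of_not_ge hW), norm_zero]
    exact le_max_right _ _

/-- **Picard–Lindelöf data** for the cut-off field on `[-T, T]`, for all initial points in
`closedBall 0 ρ₀ ⊇ SU(n)^E`. [folklore] -/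
private theorem exists_isPicardLindelof (hZ : ContDiff ℝ 1 (fun p : ℝ × AmbConfig d L n => Z p.1 p.2))
    (T : ℝ≥0) : ∃ a C K : ℝ≥0,
      IsPicardLindelof (vf Z) (tmin := -(T : ℝ)) (tmax := T) ⟨0, zero_mem_Icc T⟩ 0 a
        (ρ₀ d L n) C K := by
  obtain ⟨C, hC⟩ := exists_bound_vf hZ T
  obtain ⟨K, hK⟩ := exists_lipschitzOnWith_of_contDiff (contDiff_vf hZ) T (ρ₀ d L n + C * T)
  refine ⟨ρ₀ d L n + C * T, C, K, ?_, ?_, ?_, ?_⟩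
  · intro t ht
    exact_mod_cast hK t ht
  · intro x _
    exact ((contDiff_vf hZ).continuous.comp (continuous_id.prodMk continuous_const)).continuousOn
  · intro t ht x _
    exact hC t ht x
  · have hmax : max ((T : ℝ) - 0) (0 - -(T : ℝ)) = T := by simp
    show (C : ℝ) * max ((T : ℝ) - 0) (0 - -(T : ℝ)) ≤ _
    rw [hmax]
    push_cast
    linarith

/-- Local flows of the cut-off field on `[-T, T]`, Lipschitz in the initial point. [folklore] -/
private theorem exists_locFlow (hZ : ContDiff ℝ 1 (fun p : ℝ × AmbConfig d L n => Z p.1 p.2)) (T : ℝ≥0) :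
    ∃ α : AmbConfig d L n → ℝ → AmbConfig d L n,
      (∀ x ∈ closedBall (0 : AmbConfig d L n) (ρ₀ d L n), α x 0 = x ∧
        ∀ t ∈ Icc (-(T : ℝ)) T, HasDerivWithinAt (α x) (vf Z t (α x t)) (Icc (-(T : ℝ)) T) t) ∧
      ∃ L' : ℝ≥0, ∀ t ∈ Icc (-(T : ℝ)) T,
        LipschitzOnWith L' (α · t) (closedBall (0 : AmbConfig d L n) (ρ₀ d L n)) := by
  obtain ⟨a, C, K, h⟩ := exists_isPicardLindelof hZ T
  exact h.exists_forall_mem_closedBall_eq_hasDerivWithinAt_lipschitzOnWith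

/-- A chosen local flow of the cut-off field on `[-T, T]`. [folklore] -/
private def locFlow (hZ : ContDiff ℝ 1 (fun p : ℝ × AmbConfig d L n => Z p.1 p.2)) (T : ℝ≥0) :
    AmbConfig d L n → ℝ → AmbConfig d L n :=
  (exists_locFlow hZ T).choose

/-- Initial condition of `locFlow`. [folklore] -/
private theorem locFlow_zero (hZ : ContDiff ℝ 1 (fun p : ℝ × AmbConfig d L n => Z p.1 p.2)) (T : ℝ≥0)
    {x : AmbConfig d L n} (hx : x ∈ closedBall (0 : AmbConfig d L n) (ρ₀ d L n)) :
    locFlow hZ T x 0 = x :=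
  ((exists_locFlow hZ T).choose_spec.1 x hx).1

/-- `locFlow` solves the cut-off ODE on `[-T, T]`. [folklore] -/
private theorem hasDerivWithinAt_locFlow (hZ : ContDiff ℝ 1 (fun p : ℝ × AmbConfig d L n => Z p.1 p.2))
    (T : ℝ≥0) {x : AmbConfig d L n} (hx : x ∈ closedBall (0 : AmbConfig d L n) (ρ₀ d L n)) {t : ℝ}
    (ht : t ∈ Icc (-(T : ℝ)) T) :
    HasDerivWithinAt (locFlow hZ T x) (vf Z t (locFlow hZ T x t)) (Icc (-(T : ℝ)) T) t :=
  ((exists_locFlow hZ T).choose_spec.1 x hx).2 t ht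

/-- `locFlow` is Lipschitz in the initial point, uniformly on `[-T, T]`. [folklore] -/
private theorem exists_lipschitzOnWith_locFlow
    (hZ : ContDiff ℝ 1 (fun p : ℝ × AmbConfig d L n => Z p.1 p.2)) (T : ℝ≥0) :
    ∃ L' : ℝ≥0, ∀ t ∈ Icc (-(T : ℝ)) T,
      LipschitzOnWith L' (locFlow hZ T · t) (closedBall (0 : AmbConfig d L n) (ρ₀ d L n)) :=
  (exists_locFlow hZ T).choose_spec.2

/-! ### Invariance of `SU(n)^E` and the true equation on it -/

/-- **Invariance**: the local flow started at an `SU(n)` configuration stays in `SU(n)^E` on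
`[-T, T]` (the cut-off field is "(anti-Hermitian traceless) × link" linkwise). [folklore] -/
private theorem locFlow_mem_SU (hZ : ContDiff ℝ 1 (fun p : ℝ × AmbConfig d L n => Z p.1 p.2)) (T : ℝ≥0)
    (U : GaugeConfig d L (Matrix.specialUnitaryGroup (Fin n) ℂ)) {t : ℝ} (ht : t ∈ Icc (-(T : ℝ)) T)
    (e : Edge d L) : locFlow hZ T (coeConfig U) t e ∈ Matrix.specialUnitaryGroup (Fin n) ℂ := by
  refine mem_SU_of_ode (A := fun τ => locFlow hZ T (coeConfig U) τ e)
    (X := fun τ => -(cutoff (locFlow hZ T (coeConfig U) τ) •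
      suProj (Z τ (locFlow hZ T (coeConfig U) τ) e)))
    (zero_mem_Icc T) (fun τ hτ => ?_) (fun τ _ => ?_) (fun τ _ => ?_) ?_ t ht
  · have h := (hasDerivWithinAt_pi.1 (hasDerivWithinAt_locFlow hZ T (coeConfig_mem_closedBall U) hτ)) e
    rw [vf_apply] at h
    rw [neg_neg]
    exact h
  · rw [Matrix.conjTranspose_neg, Matrix.conjTranspose_smul, conjTranspose_suProj, star_trivial,
      smul_neg, neg_neg]
  · rw [Matrix.trace_neg, Matrix.trace_smul, trace_suProj, smul_zero, neg_zero]
  · rw [locFlow_zero hZ T (coeConfig_mem_closedBall U), coeConfig_apply]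
    exact (U e).2

/-- The local flow at time `t ∈ [-T, T]` from an `SU(n)` configuration, as an `SU(n)` configuration.
[folklore] -/
private def locFlowSU (hZ : ContDiff ℝ 1 (fun p : ℝ × AmbConfig d L n => Z p.1 p.2)) (T : ℝ≥0)
    (U : GaugeConfig d L (Matrix.specialUnitaryGroup (Fin n) ℂ)) (t : ℝ) (ht : t ∈ Icc (-(T : ℝ)) T) :
    GaugeConfig d L (Matrix.specialUnitaryGroup (Fin n) ℂ) :=
  fun e => ⟨locFlow hZ T (coeConfig U) t e, locFlow_mem_SU hZ T U ht e⟩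

/-- `locFlowSU` read in the ambient space is `locFlow`. [folklore] -/
private theorem coeConfig_locFlowSU (hZ : ContDiff ℝ 1 (fun p : ℝ × AmbConfig d L n => Z p.1 p.2))
    (T : ℝ≥0) (U : GaugeConfig d L (Matrix.specialUnitaryGroup (Fin n) ℂ)) (t : ℝ)
    (ht : t ∈ Icc (-(T : ℝ)) T) : coeConfig (locFlowSU hZ T U t ht) = locFlow hZ T (coeConfig U) t :=
  rfl

/-- On `SU(n)^E` the cut-off is inactive and the projection is the identity on a TANGENT generator:
the cut-off field is the true field there. [folklore] -/
private theorem vf_coeConfig (hZt : Z.IsTangent) (t : ℝ)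
    (U : GaugeConfig d L (Matrix.specialUnitaryGroup (Fin n) ℂ)) :
    vf Z t (coeConfig U) = vf₀ Z t (coeConfig U) := by
  funext e
  obtain ⟨h1, h2⟩ := (mem_suAlgebra_iff _).1 (hZt t U e)
  rw [vf_apply, vf₀_apply, cutoff_eq_one ((sqNorm_coeConfig_le U).trans (by linarith)), one_smul,
    suProj_eq_self h1 h2]

/-- Along the invariant set the local flow solves the TRUE flow equation. [folklore] -/
private theorem hasDerivWithinAt_locFlow_vf₀ (hZ : ContDiff ℝ 1 (fun p : ℝ × AmbConfig d L n => Z p.1 p.2))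
    (hZt : Z.IsTangent) (T : ℝ≥0) (U : GaugeConfig d L (Matrix.specialUnitaryGroup (Fin n) ℂ))
    {t : ℝ} (ht : t ∈ Icc (-(T : ℝ)) T) :
    HasDerivWithinAt (locFlow hZ T (coeConfig U)) (vf₀ Z t (locFlow hZ T (coeConfig U) t))
      (Icc (-(T : ℝ)) T) t := by
  have h := hasDerivWithinAt_locFlow hZ T (coeConfig_mem_closedBall U) ht
  rwa [← coeConfig_locFlowSU hZ T U t ht, vf_coeConfig hZt, coeConfig_locFlowSU] at h

/-- The local flow from an `SU(n)` configuration solves the true equation at interior times. [folklore] -/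
private theorem hasDerivAt_locFlow (hZ : ContDiff ℝ 1 (fun p : ℝ × AmbConfig d L n => Z p.1 p.2))
    (hZt : Z.IsTangent) (T : ℝ≥0) (U : GaugeConfig d L (Matrix.specialUnitaryGroup (Fin n) ℂ))
    {t : ℝ} (ht : t ∈ Ioo (-(T : ℝ)) T) :
    HasDerivAt (locFlow hZ T (coeConfig U)) (vf₀ Z t (locFlow hZ T (coeConfig U) t)) t :=
  (hasDerivWithinAt_locFlow_vf₀ hZ hZt T U (Ioo_subset_Icc_self ht)).hasDerivAt
    (Icc_mem_nhds ht.1 ht.2)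

/-- The local flow from an `SU(n)` configuration is continuous on `[-T, T]`. [folklore] -/
private theorem continuousOn_locFlow (hZ : ContDiff ℝ 1 (fun p : ℝ × AmbConfig d L n => Z p.1 p.2))
    (T : ℝ≥0) (U : GaugeConfig d L (Matrix.specialUnitaryGroup (Fin n) ℂ)) :
    ContinuousOn (locFlow hZ T (coeConfig U)) (Icc (-(T : ℝ)) T) :=
  HasDerivWithinAt.continuousOn fun _ ht => hasDerivWithinAt_locFlow hZ T (coeConfig_mem_closedBall U) ht

/-- Two local flows from the same `SU(n)` configuration agree on the smaller time interval. [folklore] -/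
private theorem locFlow_eqOn (hZ : ContDiff ℝ 1 (fun p : ℝ × AmbConfig d L n => Z p.1 p.2))
    (hZt : Z.IsTangent) (U : GaugeConfig d L (Matrix.specialUnitaryGroup (Fin n) ℂ)) {T₁ T₂ : ℝ≥0}
    (h0 : 0 < T₁) (h12 : T₁ ≤ T₂) :
    EqOn (locFlow hZ T₁ (coeConfig U)) (locFlow hZ T₂ (coeConfig U)) (Icc (-(T₁ : ℝ)) T₁) := by
  have h0' : (0 : ℝ) < T₁ := h0
  have h12' : (T₁ : ℝ) ≤ T₂ := h12
  refine eqOn_of_isSolution hZ h0' (continuousOn_locFlow hZ T₁ U)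
    (fun t ht => hasDerivAt_locFlow hZ hZt T₁ U ht)
    ((continuousOn_locFlow hZ T₂ U).mono (Icc_subset_Icc (by linarith) h12'))
    (fun t ht => hasDerivAt_locFlow hZ hZt T₂ U ⟨by linarith [ht.1], lt_of_lt_of_le ht.2 h12'⟩) ?_
  rw [locFlow_zero hZ T₁ (coeConfig_mem_closedBall U), locFlow_zero hZ T₂ (coeConfig_mem_closedBall U)]

/-! ### The global flow line and the flow map -/

/-- The global ambient flow line through `U`: at time `t`, the local flow on `[-(|t|+1), |t|+1]`.
[folklore] -/
private def ambLine (hZ : ContDiff ℝ 1 (fun p : ℝ × AmbConfig d L n => Z p.1 p.2))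
    (U : GaugeConfig d L (Matrix.specialUnitaryGroup (Fin n) ℂ)) (t : ℝ) : AmbConfig d L n :=
  locFlow hZ (Tof t) (coeConfig U) t

/-- The global flow line agrees with every local flow whose time interval contains `t` in its
interior. [folklore] -/
private theorem ambLine_eq_locFlow (hZ : ContDiff ℝ 1 (fun p : ℝ × AmbConfig d L n => Z p.1 p.2))
    (hZt : Z.IsTangent) (U : GaugeConfig d L (Matrix.specialUnitaryGroup (Fin n) ℂ)) {T : ℝ≥0}
    {t : ℝ} (ht : |t| < (T : ℝ)) : ambLine hZ U t = locFlow hZ T (coeConfig U) t := by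
  unfold ambLine
  have hT : (0 : ℝ≥0) < T := by
    have : (0 : ℝ) < T := (abs_nonneg t).trans_lt ht
    exact_mod_cast this
  have hTof : (0 : ℝ≥0) < Tof t := by
    have : (0 : ℝ) < Tof t := (abs_nonneg t).trans_lt (abs_lt_Tof t)
    exact_mod_cast this
  rcases le_total (Tof t) T with h | h
  · exact locFlow_eqOn hZ hZt U hTof h (mem_Icc_of_abs_lt (abs_lt_Tof t))
  · exact (locFlow_eqOn hZ hZt U hT h (mem_Icc_of_abs_lt ht)).symm

/-- The global ambient flow line solves the true flow equation at every time. [folklore] -/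
private theorem hasDerivAt_ambLine (hZ : ContDiff ℝ 1 (fun p : ℝ × AmbConfig d L n => Z p.1 p.2))
    (hZt : Z.IsTangent) (U : GaugeConfig d L (Matrix.specialUnitaryGroup (Fin n) ℂ)) (t : ℝ) :
    HasDerivAt (ambLine hZ U) (vf₀ Z t (ambLine hZ U t)) t := by
  set T : ℝ≥0 := ⟨|t| + 2, by positivity⟩ with hTdef
  have hT : |t| < (T : ℝ) := by
    show |t| < |t| + 2
    linarith
  have heq : ambLine hZ U =ᶠ[𝓝 t] locFlow hZ T (coeConfig U) := by
    have hmem : {s : ℝ | |s| < (T : ℝ)} ∈ 𝓝 t := (isOpen_lt continuous_abs continuous_const).mem_nhds hT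
    filter_upwards [hmem] with s hs
    exact ambLine_eq_locFlow hZ hZt U hs
  have ht : t ∈ Ioo (-(T : ℝ)) T := ⟨(abs_lt.1 hT).1, (abs_lt.1 hT).2⟩
  rw [ambLine_eq_locFlow hZ hZt U hT]
  exact (hasDerivAt_locFlow hZ hZt T U ht).congr_of_eventuallyEq heq

/-- The global ambient flow line stays in `SU(n)^E`. [folklore] -/
private theorem ambLine_mem_SU (hZ : ContDiff ℝ 1 (fun p : ℝ × AmbConfig d L n => Z p.1 p.2))
    (U : GaugeConfig d L (Matrix.specialUnitaryGroup (Fin n) ℂ)) (t : ℝ) (e : Edge d L) :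
    ambLine hZ U t e ∈ Matrix.specialUnitaryGroup (Fin n) ℂ :=
  locFlow_mem_SU hZ (Tof t) U (mem_Icc_of_abs_lt (abs_lt_Tof t)) e

/-- Initial condition of the global ambient flow line. [folklore] -/
private theorem ambLine_zero (hZ : ContDiff ℝ 1 (fun p : ℝ × AmbConfig d L n => Z p.1 p.2))
    (U : GaugeConfig d L (Matrix.specialUnitaryGroup (Fin n) ℂ)) : ambLine hZ U 0 = coeConfig U :=
  locFlow_zero hZ (Tof 0) (coeConfig_mem_closedBall U)

/-- **The flow map** `Φ_t(V)` of a `C¹` tangent generator: the global flow line through `V` at time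
`t`, as an `SU(n)` configuration. [cite: Luscher2010Trivializing, §3.2] -/
def flowMap (hZ : ContDiff ℝ 1 (fun p : ℝ × AmbConfig d L n => Z p.1 p.2)) (t : ℝ)
    (V : GaugeConfig d L (Matrix.specialUnitaryGroup (Fin n) ℂ)) :
    GaugeConfig d L (Matrix.specialUnitaryGroup (Fin n) ℂ) :=
  fun e => ⟨ambLine hZ V t e, ambLine_mem_SU hZ V t e⟩

/-- `flowMap` read in the ambient space is `ambLine`. [folklore] -/
private theorem coeConfig_flowMap (hZ : ContDiff ℝ 1 (fun p : ℝ × AmbConfig d L n => Z p.1 p.2)) (t : ℝ)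
    (V : GaugeConfig d L (Matrix.specialUnitaryGroup (Fin n) ℂ)) :
    coeConfig (flowMap hZ t V) = ambLine hZ V t := rfl

/-- **Global existence**: `flowMap` is an integrated transformation of the generator (`Φ 0 = id`,
every `t ↦ Φ t V` is a flow line). [cite: Luscher2010Trivializing, §3.1–§3.2] -/
theorem isFlowMap_flowMap (hZ : ContDiff ℝ 1 (fun p : ℝ × AmbConfig d L n => Z p.1 p.2))
    (hZt : Z.IsTangent) : IsFlowMap Z (flowMap hZ) := by
  refine ⟨fun V => ?_, fun V t e i j => ?_⟩
  · apply coeConfig_injective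
    rw [coeConfig_flowMap, ambLine_zero]
  · have h := (hasDerivAt_pi.1 (hasDerivAt_ambLine hZ hZt V t)) e
    rw [vf₀_apply, ← coeConfig_flowMap] at h
    exact hasDerivAt_entry h i j

omit [NeZero L] in
/-- A flow line in the sense of `IsFlowLine` (entrywise), read as a curve in the ambient normed space,
solves `Ẇ = vf₀ Z t W` — the flow equation (3.2) in the ambient normed space.
[cite: Luscher2010Trivializing, §3.1 eq. (3.2)] -/
theorem hasDerivAt_of_isFlowLine {U : ℝ → AmbConfig d L n} (hU : IsFlowLine Z U) (t : ℝ) :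
    HasDerivAt U (vf₀ Z t (U t)) t :=
  hasDerivAt_pi.2 fun e => hasDerivAt_of_entries fun i j => hU t e i j

/-- **Uniqueness**: every ambient flow line through an `SU(n)` configuration is the global flow line.
[cite: Luscher2010Trivializing, §3.1] -/
theorem eq_flowMap_of_isFlowLine (hZ : ContDiff ℝ 1 (fun p : ℝ × AmbConfig d L n => Z p.1 p.2))
    (hZt : Z.IsTangent) {U : ℝ → AmbConfig d L n}
    {V : GaugeConfig d L (Matrix.specialUnitaryGroup (Fin n) ℂ)} (hU : IsFlowLine Z U)
    (h0 : U 0 = coeConfig V) (t : ℝ) : U t = coeConfig (flowMap hZ t V) := by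
  have hT : (0 : ℝ) < |t| + 1 := by positivity
  have hUc : Continuous U := continuous_iff_continuousAt.2 fun s => (hasDerivAt_of_isFlowLine hU s).continuousAt
  have hΦc : Continuous (ambLine hZ V) :=
    continuous_iff_continuousAt.2 fun s => (hasDerivAt_ambLine hZ hZt V s).continuousAt
  have key := eqOn_of_isSolution hZ hT hUc.continuousOn (fun s _ => hasDerivAt_of_isFlowLine hU s)
    hΦc.continuousOn (fun s _ => hasDerivAt_ambLine hZ hZt V s) (by rw [h0, ambLine_zero])
  exact key (mem_Icc_of_abs_lt (T := Tof t) (abs_lt_Tof t))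

/-- **Continuous dependence**: `(t, V) ↦ Φ_t(V)` is jointly continuous (local flows are Lipschitz in
the initial point and `Φ` is locally one of them). [cite: Luscher2010Trivializing, §3.1] -/
theorem continuous_flowMap (hZ : ContDiff ℝ 1 (fun p : ℝ × AmbConfig d L n => Z p.1 p.2))
    (hZt : Z.IsTangent) :
    Continuous (fun p : ℝ × GaugeConfig d L (Matrix.specialUnitaryGroup (Fin n) ℂ) =>
      flowMap hZ p.1 p.2) := by
  refine continuous_iff_continuousAt.2 fun p => ?_
  set T : ℝ≥0 := ⟨|p.1| + 2, by positivity⟩ with hTdef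
  have hT : |p.1| < (T : ℝ) := by
    show |p.1| < |p.1| + 2
    linarith
  have hTT : -(T : ℝ) ≤ T := by linarith [T.coe_nonneg]
  obtain ⟨L', hL'⟩ := exists_lipschitzOnWith_locFlow hZ T
  have hco : ContinuousOn (fun q : AmbConfig d L n × ℝ => locFlow hZ T q.1 q.2)
      (closedBall (0 : AmbConfig d L n) (ρ₀ d L n) ×ˢ Icc (-(T : ℝ)) T) :=
    continuousOn_prod_of_continuousOn_lipschitzOnWith _ L'
      (fun x hx => HasDerivWithinAt.continuousOn fun t ht => hasDerivWithinAt_locFlow hZ T hx ht) hL'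
  -- a clamped time, so that the local flow can be composed with a globally defined continuous map
  set clampT : ℝ → ℝ := fun t => max (-(T : ℝ)) (min (T : ℝ) t) with hclamp
  have hclamp_mem : ∀ t, clampT t ∈ Icc (-(T : ℝ)) T :=
    fun t => ⟨le_max_left _ _, max_le hTT (min_le_left _ _)⟩
  have hclamp_eq : ∀ t, |t| < (T : ℝ) → clampT t = t := fun t ht => by
    have h1 := abs_lt.1 ht
    simp only [hclamp, min_eq_right h1.2.le, max_eq_right h1.1.le]
  have hg : Continuous fun q : ℝ × GaugeConfig d L (Matrix.specialUnitaryGroup (Fin n) ℂ) =>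
      locFlow hZ T (coeConfig q.2) (clampT q.1) := by
    have hf : Continuous fun q : ℝ × GaugeConfig d L (Matrix.specialUnitaryGroup (Fin n) ℂ) =>
        (coeConfig q.2, clampT q.1) :=
      (continuous_coeConfig.comp continuous_snd).prodMk
        ((continuous_const.max (continuous_const.min continuous_id)).comp continuous_fst)
    exact hco.comp_continuous hf fun q => ⟨coeConfig_mem_closedBall q.2, hclamp_mem q.1⟩
  have hnhds : ∀ᶠ q in 𝓝 p, coeConfig (flowMap hZ q.1 q.2) = locFlow hZ T (coeConfig q.2) (clampT q.1) := by
    have hmem : {q : ℝ × GaugeConfig d L (Matrix.specialUnitaryGroup (Fin n) ℂ) | |q.1| < (T : ℝ)} ∈ 𝓝 p :=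
      (isOpen_lt (continuous_abs.comp continuous_fst) continuous_const).mem_nhds hT
    filter_upwards [hmem] with q hq
    rw [hclamp_eq q.1 hq, coeConfig_flowMap, ambLine_eq_locFlow hZ hZt q.2 hq]
  refine continuousAt_pi.2 fun e => ?_
  rw [Topology.IsInducing.subtypeVal.continuousAt_iff]
  have h3 : ContinuousAt (fun q : ℝ × GaugeConfig d L (Matrix.specialUnitaryGroup (Fin n) ℂ) =>
      locFlow hZ T (coeConfig q.2) (clampT q.1) e) p :=
    ((continuous_apply e).comp hg).continuousAt
  refine h3.congr ?_
  filter_upwards [hnhds] with q hq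
  show locFlow hZ T (coeConfig q.2) (clampT q.1) e =
    ((flowMap hZ q.1 q.2 e : Matrix.specialUnitaryGroup (Fin n) ℂ) : Matrix (Fin n) (Fin n) ℂ)
  rw [← coeConfig_apply (flowMap hZ q.1 q.2) e, hq]

end Analysis

end FlowExistence

/-- **Lüscher §3.1, PROVED** (discharges the cited `Prop` `FlowGlobalExistence` of file A): a `C¹`
tangent generator on the field manifold `SU(n)^E` has a global flow map — jointly continuous in
`(t, V)`, with `Φ 0 = id`, every `t ↦ Φ t V` a flow line, and every ambient flow line through an
`SU(n)` configuration equal to it ("the flow equation (3.2) has a unique solution `U_t` for any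
specified initial value `U_0 = V` and all `t ∈ (-∞,∞)` … because the field manifold is compact").
[cite: Luscher2010Trivializing, §3.1 (paragraph after eq. (3.3))] -/
theorem flowGlobalExistence_holds : FlowGlobalExistence d L n := by
  intro _ Z hZ hZt
  exact ⟨FlowExistence.flowMap hZ, FlowExistence.isFlowMap_flowMap hZ hZt,
    FlowExistence.continuous_flowMap hZ hZt,
    fun U V hU h0 t => FlowExistence.eq_flowMap_of_isFlowLine hZ hZt hU h0 t⟩

end Literature.MathematicalPhysics.QuantumFieldTheory.Luscher2010

end
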